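import Summits.BirchSwinnertonDyer.Rank1Residual.F1Sign2.KummerDeformationAtTwo
import HarnessLib.Audit.Tags
import HarnessLib

/-!
# Cell `bsd-f1-sign2` — analytic lens (planner `-an` g24; MEMO-an v1.66–1.67 §27.9–§27.10): AN-42 «THE OCTAHEDRAL AVATAR» — the Kummer deformation of `ρ̄_{E,2}` along
# `κ_P` as the mod-2 reduction of an octahedral Artin representation over `ℤ[√−2]`, and the SUPERSINGULAR HALVING RECIPROCITY it forces (carrier
# `HalvingQuarticSolvableOver`; AN-42b `OctahedralWeightOneAvatarAtTwo` IN REF1's REPAIRED FORM C′, AN-42d `SupersingularHalvingReciprocity`; -an's kernel K42 (`GL₂(𝔽₃) ≅ 2·S₄ ⊂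
# GL₂(ℤ[√−2])`, the digit law) and REF1 §210's K210.1/2a/2/6 live in the sibling `OctahedralAvatarAtTwoKernel.lean`)

STATEMENTS ONLY (typer -ty g19).  Source: `HOME/MEMO-an-data/g24/lean/Sketch_g24.lean` revision **4fee0acee7fec01d** l.170–230 (= `HOME/REF1-data/b210/Sketch_g24v2.lean`, the text REF1 audited
in §210; its AN-41 part l.1–169 = the §207 text, ported as `KummerDeformationAtTwo.lean` p729735, imported here for `pointKummerBit`) and REF1's `HOME/REF1-data/b210/K210.lean`
**29f8851492bb1149** (the three AN-42 decls VERBATIM under `…F1Sign2.REF1s210` + probes + K210.1–6 + the repaired C′ text `OctahedralWeightOneAvatarAtTwo'` l.139–147; farm rc 0, exactly 3 probe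
sorries, `#print axioms K210_4` std).  NOT ported here: -an's later additions to the sketch (revision da59018d26a79b5d, after the audit: AN-42d′ `SupersingularHalvingReciprocityOddDisc` + glue
`supersingularHalvingReciprocityOddDisc_of`, AN-42d″ `SupersingularPointsHalveAtConductor`, MEMO-an §27.11) — REF-GATED until REF1 audits them; they only ADD declarations.
PORT GATE = REF1-AUDIT §210 R210a (INBOX 2026-08-29T16:00:37Z, BLOCKING): **AN-42b is filed ONLY in REF1's repaired form C′** — the level clause `2 * N ∣ M ∧` becomes `0 < M ∧ 2 * N ∣ M ∧`
(REF1's text verbatim; builder-verified: C′ = the sketched body with exactly this insertion), under -an's name with a rider (the AN-40 precedent, p726556: killed-as-typed rows land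
only in their C′ form); carrier and AN-42d VERBATIM (R210d).  WHY (REF1 §210 K210.4, kernel, std axioms): AS SKETCHED `∃ M` admits `M = 0` — `2N ∣ 0`, no prime `ℓ ∤ 0` (K210.1), and
Mathlib's `CongruenceSubgroup.Gamma1 0` is the unipotent group `{(1 b; 0 1)}` (`ZMod 0 = ℤ`; K210.2a) whose only cusp is `∞` (K210.2), on which the slash action is weight-independent, so
the weight-2 newform `f_E` re-types as a term of `CuspForm (Gamma1 0) 1` with the same `cuspCoeff` (K210.3) and `exists_isNewformOf → OctahedralWeightOneAvatarAtTwo` (K210.4): the sketched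
row is a corollary of MODULARITY ALONE («provable for the wrong reason», class misstated); the junk witness misses C′ (for `M > 0`, `Γ₁(M) ∋ (1 0; M 1)` moves a weight-2 form).  STANDING
TYPING RULE R210c (all planners, -ty): never quantify a level existentially without `0 < M` / `[NeZero M]` — Mathlib's `Gamma1 0`, `Gamma0 0`, `Gamma 0` are the unipotent / Borel / trivial
subgroups with cusp set `{∞}` (AN-41a's fixed level `4·conductorNorm` with `NeZero` is not affected).  TAGS (typer): AN-42d `@[conjecture]` (R210d); C′ filed `@[conjecture]` at 16:5xZ (p731709) and RE-FILED PLAIN by the v2 fold once REF2 v54 §21 (16:10:05Z) placed AN-42b′ as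
COROLLARY OF PRINT — R210a allows a plain `def` «if REF2 places Bayer–Frey Cor. 2.7»; C′ is a THEOREM-CANDIDATE = consequence of print (Bayer–Frey 1991 Props
2.3–2.5 / Cor. 2.7 + Tunnell 1981) + -an's K42 mod-2 identity + the census-identified local law at `N` — the tag can be dropped by a re-filing once REF2 places it.  CITES (typer; the
sketch's AN-42 docstrings carry prose references only): `Tunnell1981` (BAMS 5, Artin for octahedral type ✓ in bib); NEW KEYS added by the typer (`ledger bib add`, 16:4xZ): `BayerFrey1991`
(Math. Z. 207, doi 10.1007/bf02571397 — NOT held, want acq-14680; cited via Pacetti), `Serre1984Witt` (Comment. Math. Helv. 59 — J.-P. Serre «L'invariant de Witt de la forme Tr(x²)»;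
the tree's bare key `Serre1984` is D. Serre on the Euler equation, NOT meant), `Pacetti2005Embedding` (arXiv math/0507381 «On the embedding problem for 2⁺S₄ representations», HELD:
p0004 Prop. 1.1 = Bayer–Frey Prop. 1.1 (cocycles in `H¹(G_ℚ, E[2]) ∖ 0` ↔ `S₄`-fields `N ⊃ L = ℚ(E[2])`), p0005 L117–118 / p0006 L6 «By Theorem 1 of [Serre] the obstruction …»,
p0006 L31–33 «a weight 1 modular form with character (Disc(K)/·) and minimum level.  See [Bayer], Proposition 2.3, 2.4 and 2.5»).
GRADES (REF1-AUDIT §210, `HOME/REF1-AUDIT-v1.md`; evidence `HOME/REF1-data/b210/` SHA16.txt: `K210.lean` 29f8851492bb1149, `an42d.py` d09e1823e853af14 → `an42d.txt` 084371191d4d4ff1,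
`xcheck42.py` → `xcheck42.txt` a255e925d16bceca): carrier **SURVIVES** (faithful duplication-formula typing, Silverman AEC III.2.3(d); guard `ψ(t) ≠ 0`; K210.6 monotone along
`ℚ`-algebra maps, so `P ∈ 2E(ℚ)` makes every instance true — degenerate case consistent); **AN-42b KILLED AS TYPED (misstated) → C′ SURVIVES as THEOREM-CANDIDATE** (port only C′);
**AN-42d SURVIVES `@[conjecture]`** — theorem-candidate modulo -an's open 2-adic lemma L₂ˢˢ; REF1's INDEPENDENT CENSUS widened BC5 from -an's K42b (61 supersingular curves,
`N < 5 000`, Hilbert-symbol obstructions) to ALL prime conductors `N < 500 000` (Cremona `allgens`): 3 737 rank `≥ 1` curves (all with `ρ̄_{E,2}` onto), 1 867 supersingular at 2;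
**2 562/2 562 generator-points with `bit_∞ = bit_N`** (Δ<0: 1 545 × (0,0) — every rational point of these 1 136 curves is 2-divisible in `E(ℚ_N)`; Δ>0: 304 × (0,0) + 713 × (1,1));
0 counterexamples; the ordinary cell fails 60 % (1 027/2 563 agree) — `Even (W.LFunction 2)` is LOAD-BEARING; two-engine cross-check vs -an's `k42_obstruction.json`: `bit_∞ = [e_∞ =
−1]` 122/122, `bit_N = [e_N = −1]` 122/122.  K42 (`K42_Octahedral.lean` c9d12a46afa6210b): compiles as claimed (rc 0, `decide`) — certifies the finite-group half of «`ρ_P` mod 2 =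
the Kummer first-order deformation» (48 elements, kernel of reduction `±(1 + wT)`, digit law); the Galois-theoretic identification K42 ⟹ `v_ℓ ≡ t_P(ℓ)` is paper-level (§27.9),
consistent with -an's K42d 229/229 digits (kit j333019/j333166/j333248: 43a1 → level 2³·43, 331a1 → 331, 563a1 → 563; not re-run by REF1).  R210b (-an, optional sharpening of C′ to
THE Bayer–Frey newform, `M = 2^a·N`, `a ≤ 8`) and R210e (cheapest remaining falsifier of AN-42d = the finite 2-adic enumeration L₂ˢˢ, one kit job) are -an's.  REF2 placement: PENDING
at port time (asked by REF1 §210; Langlands–Tunnell / Bayer–Frey / Kiming's obstructed-`M₂` table are the obvious neighbours — -an §27.9: «the Heegner-index-parity slot `s` of §26 is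
the `√−2`-digit of a weight-one form»).  BC5 (MEMO-an §27.9–27.10, `HOME/MEMO-an-data/g24/`: K42b census 122 rank `≥ 1` prime-conductor curves `N < 5000`, exact Hilbert-symbol
arithmetic: `e_∞ = −1 ⟺ P ∉ E⁰(ℝ)` 41/41, `e_N = −1 ⟺ P ∉ 2E(ℚ_N)` 89/89, supersingular ⟹ `e₂ = +1` 61/61; K42c/d/e weight-one searches).  Why novel (one sentence, -an §27.9): the
octahedral weight-one avatar reads the cell's ± datum `t_P` as the `√−2`-digit of a classical weight-one form — Bayer–Frey construct the form, the digit reading and the halving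
reciprocity at supersingular 2 are the cell's.  PARTITION none.  Beyond-print theorem: no (C′ print-assembly + K42; AN-42d conjecture).  BSD is not proved; 23715 not closed.
bears_on: stmt-BirchSwinnertonDyer-23715.

## -an's §27.9 section docstring of `Sketch_g24.lean` (verbatim)

 ## AN-42 — THE OCTAHEDRAL AVATAR (g24, second half).
`Gal(ℚ(E[2], ½P)/ℚ) ≅ S₄ ≅ PGL₂(𝔽₃)`.  Kernel theorem K42 (file `OctahedralDigitLawK42.lean`, all `decide`): in the (unique up to
homothety) stable `ℤ₂[√−2]`-lattice of the faithful 2-dimensional representation of `GL₂(𝔽₃) ≅ 2·S₄`, reduction MODULO `2 = −(√−2)²`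
has image `S₄ ⊂ GL₂(𝔽₂[ε])` (`ε = √−2 mod 2`), equal to `ρ̄ ⊗ (1 + ε·τ_c)` with `c` the tautological `V₄ ≅ E[2]` cocycle, and
`tr(g) ≡ [g ↦ 3-cycle] + ε·[g ↦ 4-cycle] (mod 2)`.  Hence (AN-42a) whenever the embedding problem `S₄ → GL₂(𝔽₃)` for `ℚ(E[2],½P)` is
solvable (Serre 1984, Thm 1: `w₂(Tr x²) + (2)(d) = 0`), the Kummer deformation `ρ̄ ⊗ (1 + ε τ_{κ_P})` IS the mod-2 reduction of an
Artin representation `ρ_P : G_ℚ → GL₂(ℤ[√−2])`, `tr ρ_P(Frob_ℓ) ≡ a_ℓ(E) + √−2·t_P(ℓ) (mod 2)`; (AN-42b) if moreover `Δ_E < 0`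
(complex conjugation = transposition ⇒ `ρ_P` odd) then by Langlands–Tunnell `ρ_P` is the representation of an octahedral
weight-ONE newform `h_P = Σ (u_n + v_n √−2) qⁿ` and **`v_ℓ ≡ t_P(ℓ) (mod 2)`**: the Heegner-index-parity slot `s` of §26 is the
`√−2`-digit of a weight-one form.  Census K42b (122 rank ≥ 1 prime-conductor curves, `N < 5000`, exact Hilbert-symbol arithmetic):
local obstructions `e_∞ = −1 ⟺ P ∉ E⁰(ℝ)` (41/41), `e_N = −1 ⟺ P ∉ 2E(ℚ_N)` (89/89 curves with local rows), `E` supersingular at `2 ⇒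
e₂ = +1` (61/61); for `Δ_E < 0` the problem is unobstructed iff `P ∈ 2E(ℚ_N)` (46 of 74).  AN-42d below is the reciprocity these force.
-/

namespace Summit.BirchSwinnertonDyer.Rank1Residual.F1Sign2.ANg24

open Literature.NumberTheory.EllipticCurves Literature.NumberTheory.EllipticCurves.ModularForms UpperHalfPlane
open Summit.BirchSwinnertonDyer.Rank1Residual.F1Sign2
open Summit.BirchSwinnertonDyer.Rank1Residual.F1Sign2.TranspositionDoor
open scoped ModularForm
open CongruenceSubgroup
open scoped Classical

/-! ### §42 The halving quartic, AN-42b (C′) and AN-42d -/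

/-- The `2`-division ("halving") quartic of the abscissa `x₀` is solvable over the `ℚ`-algebra `K`
(`K = ℝ`: `P ∈ 2E(ℝ) = E⁰(ℝ)`; `K = ℚ_N`: `P ∈ 2E(ℚ_N)`, for `P = (x₀, y₀)` of infinite order; cf. `WildPacket.TwoDivisionQuarticSolvableAtTwo`).
(Typer -ty g19, REF1-AUDIT §210: carrier **SURVIVES**, VERBATIM — (A2) `ψ(t) = 4t³ + b₂t² + 2b₄t + b₆`, `φ(t) = t⁴ − b₄t² − 2b₆t − b₈`, `x([2]Q) = φ/ψ` (Silverman AEC III.2.3(d)) ✓; the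
guard `ψ(t) ≠ 0` excludes `Q ∈ E[2]`; for `P = (x₀, y₀) ∈ E(ℚ)` of infinite order and a field `K ⊃ ℚ`: `∃ Q ∈ E(K), 2Q = P ⟺ HalvingQuarticSolvableOver K W x₀` (the
`y`-coordinate is automatic); K210.6 (kernel file): monotone along `ℚ`-algebra maps of fields.  R210d: sharing with `WildPacket.TwoDivisionQuarticSolvableAtTwo` only if the latter
has the same guard — it is a different predicate (at `2`, on `W`-points), so this carrier stays.) -/
def HalvingQuarticSolvableOver (K : Type*) [Field K] [Algebra ℚ K] (W : WeierstrassCurve ℚ) (x₀ : ℚ) : Prop :=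
  ∃ t : K, 4 * t ^ 3 + algebraMap ℚ K W.b₂ * t ^ 2 + 2 * algebraMap ℚ K W.b₄ * t + algebraMap ℚ K W.b₆ ≠ 0 ∧
    t ^ 4 - algebraMap ℚ K W.b₄ * t ^ 2 - 2 * algebraMap ℚ K W.b₆ * t - algebraMap ℚ K W.b₈ =
      algebraMap ℚ K x₀ * (4 * t ^ 3 + algebraMap ℚ K W.b₂ * t ^ 2 + 2 * algebraMap ℚ K W.b₄ * t + algebraMap ℚ K W.b₆)

/-- **AN-42b — FILED ONLY IN REF1 §210's REPAIRED FORM C′ (`0 < M ∧ 2N ∣ M`; R210a) — (THEOREM-CANDIDATE modulo writing: K42 + Serre 1984 Thm 1 + Tunnell 1981 + the census-identified local law at `N`;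
kit test K42c pending).**  `N` prime, `ρ̄_{E,2}` onto, `Δ_E < 0`, `P = (x,y) ∈ E(ℚ)` of infinite order with `P ∈ 2E(ℚ_N)`: there is a
weight-one cusp form `F` of some level `M`, `2N ∣ M`, with `q`-expansion `Σ (uₙ + vₙ√−2) qⁿ`, `u₁ = 1`, such that for every prime
`ℓ ∤ M`: `u_ℓ ≡ a_ℓ(E)` and `v_ℓ ≡ t_P(ℓ)` (mod 2) — the OCTAHEDRAL WEIGHT-ONE AVATAR of the Kummer deformation.
(Typer -ty g19, REF1-AUDIT §210: **KILLED AS TYPED [misstated] — FILED ONLY IN REF1's REPAIRED FORM C′ (R210a, BLOCKING): `0 < M ∧` inserted before `2 * N ∣ M`; everything else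
VERBATIM** (= `OctahedralWeightOneAvatarAtTwo'` of `REF1-data/b210/K210.lean` l.139–147, byte-checked by the builder).  AS SKETCHED the `∃ M` admitted `M = 0`, where `2N ∣ 0`, no
prime `ℓ ∤ 0`, and `CuspForm (Gamma1 0) 1` contains the weight-2 newform of `E` (Mathlib's `Gamma1 0` = unipotent group, only cusp `∞`): K210.4 `exists_isNewformOf →` (sketched row),
kernel, std axioms — provable from modularity alone.  With C′: for `M > 0` `F` must be an honest weight-one form on `Γ₁(M)` and the clause `v_ℓ ≡ t_P(ℓ)` over the cofinite set
`ℓ ∤ M` pins the 4-cycle character of `ℚ(E[2], ½P)` (Chebotarev-exact), which no form whose Galois data factor through `S₃` can carry — C′ has the intended content (existence of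
the unobstructed `GL₂(𝔽₃)`-lift `ρ_P`).  VERDICT on C′: SURVIVES, THEOREM-CANDIDATE = consequence of print [cite: BayerFrey1991, Prop. 2.3–2.5, Cor. 2.7 (weight-one octahedral newform, not held — quoted via Pacetti)]
[cite: Pacetti2005Embedding, Prop. 1.1 and §2 p. 6 (Bayer–Frey's correspondence and weight-one form, level 2^r·N)] [cite: Serre1984Witt, Thm. 1 (obstruction w₂(Tr x²) + (2)∪(d), as quoted by Pacetti)]
[cite: Tunnell1981] + -an's K42 (kernel file) + the census-identified local law at `N`; `@[conjecture]` kept by the typer until REF2 places Bayer–Frey Cor. 2.7 (R210a) — REF2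
placement pending at port time.  R210b (optional sharpening to THE Bayer–Frey newform `h_P`: `M = 2^a·N`, `a ≤ 8`, `IsNewform`; note C′ lets `F` be a non-eigenform `F₀ + √−2·G` —
harmless, the content then sits in `G`'s prime-parity pattern) is -an's.  K42d (kit j333019/j333166/j333248): 43a1 → level 2³·43, 331a1 → 331, 563a1 → 563, digits 229/229.
FOLD -ty g19 (REF2-PLACEMENT v54 §21, INBOX 16:10:05Z — placement SERVED, so per R210a the `@[conjecture]` tag is DROPPED: this row is now a PLAIN `def`): **AN-42b′ (= this C′)
= COROLLARY OF PRINT** — Bayer–Frey Prop. 1.1 and Cor. 2.7 via [cite: Pacetti2005Embedding, p. 4 L13–20 and p. 7 (Prop. 1.1, Cor. 1.8, Cor. 1.10)], Serre's obstruction formula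
[cite: Serre1984Witt, Prop. 1 and Thm. 1 (§3.2 Prop. 1 read by REF2 on the held doi text p. 13 L21–47)], Kiming's Thm. 2 (obstructed `M₂` table), Langlands–Tunnell [cite: Tunnell1981];
the digits are the `GL₂(𝔽₃)` character table = K42 (kernel file).  -an's §27.12 weight-one READING of the Kummer deformation = NEW READING (not located in print; CE 2009 build the
scalar direction only).  REF2 §21.2–21.3 (rigorous modulo cited print, REF1 asked to audit): the cell's ± object is a LOCAL TATE PAIRING — `e_v(E,P) = (−1)^{2·inv_v(κ_P ∪ c_E)}` for
ONE global class `c_E = [−Δ_f·f′(θ)] ∈ ker(N : L^×/□ → ℚ^×/□)` (`f` the monic 2-division cubic, `θ ∈ L = ℚ[x]/f`; Poonen–Rains 2012 Cor. 4.6 / Prop. 4.10, Zarhin 1974, O'Neil 2002: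
the printed refinement `q^Z` and -an's `q_v = inv_v ∘ s` differ by `⟨·, c_E⟩`; split case = Serre 1984 §3.2 Prop. 1 + O'Neil's period-index conic, 2 227 Hilbert-symbol checks, 0
mismatches, `HOME/REF2-data-hilbcheck.py`); Serre's product formula = reciprocity for `κ_P ∪ c_E`; `L_∞ ⟺ c_{E,∞} ∉ W_∞`, `L_N ⟺ c_{E,N} ∉ W_N`, `L₂ˢˢ ⟺ c_{E,2} ∈ W₂`.
PREDICTION #16 (REF2, pre-registered): `e_v(E,P) = ∏_{w∣v} (x(P) − θ, −Δ_f·f′(θ))_{L_w}` on every row incl. the ordinary-at-2 cell.) -/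
def OctahedralWeightOneAvatarAtTwo : Prop :=
  ∀ (W : WeierstrassCurve ℚ) [W.IsElliptic] [W.IsGloballyMinimal] [W.IsIntegral ℤ] [NeZero (W.conductorNorm ℤ)]
    (N : ℕ) [Fact N.Prime], W.conductorNorm ℤ = N → W.HasSurjectiveModNGaloisRep 2 → W.Δ < 0 →
    ∀ (x y : ℚ) (h : W.toAffine.Nonsingular x y), ¬ IsOfFinAddOrder (WeierstrassCurve.Affine.Point.some _ _ h) →
      HalvingQuarticSolvableOver ℚ_[N] W x →
      ∃ (M : ℕ) (F : CuspForm (Gamma1 M) 1) (u v : ℕ → ℤ), 0 < M ∧ 2 * N ∣ M ∧ u 1 = 1 ∧ v 1 = 0 ∧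
        (∀ n : ℕ, cuspCoeff F n = (u n : ℂ) + (v n : ℂ) * (Complex.I * (Real.sqrt 2 : ℂ))) ∧
        ∀ ℓ : ℕ, ℓ.Prime → ¬ ℓ ∣ M →
          Even (u ℓ - W.LFunction ℓ) ∧ Even (v ℓ - pointKummerBit W (WeierstrassCurve.Affine.Point.some _ _ h) ℓ)

/-- **AN-42d (CONJECTURE → theorem-candidate: SUPERSINGULAR HALVING RECIPROCITY; census K42b 45/45 with local rows, 61/61 for
`e₂ = +1`).**  `N` prime, `E` supersingular at `2` (`a₂` even), `ρ̄_{E,2}` onto: a rational point of infinite order lies on the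
identity component `E⁰(ℝ) = 2E(ℝ)` iff it is `2`-divisible in `E(ℚ_N)`.  (Hilbert reciprocity for Serre's class `w₂(Tr x²)+(2)(d)` of
the halving field, given the three local laws; for `Δ_E < 0` it says `E(ℚ) ⊂ 2E(ℚ_N) + E(ℚ)_{tors}`.)
(Typer -ty g19, REF1-AUDIT §210: **SURVIVES, `@[conjecture]`** (R210d, VERBATIM) — theorem-candidate modulo -an's open 2-adic lemma L₂ˢˢ (by Honda's classification the `S₄`-algebra
`ℚ₂[X]/(halving quartic)` depends only on `a₂ ∈ {0, ±2}` and on `[P ∈ 2E(ℚ₂)]`; R210e: a finite 2-adic enumeration, one kit job).  (A2): `Even (W.LFunction 2)` = `a₂` even =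
supersingular at 2 (`N` odd prime, `IsGloballyMinimal`); `E(ℚ)[2] = 0` by `HasSurjectiveModNGaloisRep 2` and odd torsion lies in `E⁰(ℝ) ∩ 2E(ℚ_N)`, so a generator-wise census
decides the statement for ALL points.  REF1's INDEPENDENT CENSUS (`REF1-data/b210/an42d.py` → `an42d.txt` 084371191d4d4ff1; Cremona `allgens`, ALL prime `N < 500 000`; `bit_∞` by
exact Sturm counts, `bit_N` by Cantor–Zassenhaus + Hensel to depth 40, 0 undecided): **supersingular cell 2 562/2 562 generator-points with `bit_∞ = bit_N`** on 1 867 curves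
(Δ<0: 1 545 × (0,0); Δ>0: 304 × (0,0) + 713 × (1,1)), 0 counterexamples; ordinary cell 1 027/2 563 (40 %) — `Even a₂` LOAD-BEARING (fails at once at 53a1, 61a1); `ρ̄` onto is
automatic in range («N prime ∧ rank ≥ 1» ⟹ onto, 3 737/3 737).  Cross-check vs -an's K42b Hilbert-symbol table 122/122 ×2.  Mechanism (-an §27.10): Hilbert reciprocity for Serre's
class `w₂(Tr x²) + (2)∪(d)` of the halving field given the three local laws `L_∞`, `L_N`, `L₂ˢˢ` [cite: Serre1984Witt, Thm. 1 (as quoted by Pacetti 2005)].  -an's later explicit-binder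
form AN-42d′ (`Odd (padicValRat N W.Δ)`) and the `Δ < 0` corollary AN-42d″ (§27.11) are NOT filed here (post-audit; REF-gated).
FOLD -ty g19 (REF2 v54 §21.1/§21.4, 16:10:05Z): AN-42d′ (and this row) **THEOREM-CANDIDATE, NEW-COMBINATION** — by §21.2–21.3 EQUIVALENT to the one dyadic lemma L₂ˢˢ′ «`E/ℚ₂`
supersingular ⟹ `[−Δ_f·f′(θ)] ∈ δ(E(ℚ₂)/2)`» plus elementary positions (`c_{E,∞} ∉ W_∞` from the signs (−,+,−) of `−Δf′` at `e₁ < e₂ < e₃` vs `κ_egg = (+,−,−)`; `c_{E,N} ∉ W_N` from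
`v_N(−Δ f′(e₁)) = v_N(Δ)` odd); beyond-print content = that dyadic lemma; under PREDICTION #16 the row needs neither «ρ̄ onto» nor «infinite order» — only prime `N`, `v_N(Δ)` odd,
`c_{E,2} ∈ W₂`.  presearch (REF2): none (corpus hybrid + vec, galaxy).) -/
@[conjecture] def SupersingularHalvingReciprocity : Prop :=
  ∀ (W : WeierstrassCurve ℚ) [W.IsElliptic] [W.IsGloballyMinimal] [W.IsIntegral ℤ] [NeZero (W.conductorNorm ℤ)]
    (N : ℕ) [Fact N.Prime], W.conductorNorm ℤ = N → W.HasSurjectiveModNGaloisRep 2 → Even (W.LFunction 2) →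
    ∀ (x y : ℚ) (h : W.toAffine.Nonsingular x y), ¬ IsOfFinAddOrder (WeierstrassCurve.Affine.Point.some _ _ h) →
      (HalvingQuarticSolvableOver ℝ W x ↔ HalvingQuarticSolvableOver ℚ_[N] W x)

end Summit.BirchSwinnertonDyer.Rank1Residual.F1Sign2.ANg24
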